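import Mathlib
import Summits.ValiantsHypothesis.ValiantsHypothesis.Theorems.GrenetZeonTwoDimCoefficientsDualUnipotentThinNumeratorCalculus

/-!
# Crux `GrenetZeon.TwoDimCoefficients` (stmt-ValiantsHypothesis-8062) / rung `DualUnipotentThreeHalves` (stmt-24318):
# ONE-CUT ALGEBRA — the block calculus behind «a thin invariant cut forces the Hessian rate»

Groundwork (pure algebra) for the ONE-CUT HESSIAN-RATE LEMMA (next file, `…CentredCutLemma`): in the exact formula
✓ `hess0_transl_resolvent_eq_cross_const` (`Hess_p = Ψ + Ψᵀ`, `Ψ(s,t) = tr(K·N_s·K·N_t·K·E)`, `K = (1 − N(p))⁻¹`),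
suppose an idempotent `D` (projection onto a subspace `U` along `W`, `D' = 1 − D`) is INVARIANT for the pencil
(`D'·X·D = 0` for `X = N(p)` and all `N_s`: "block-upper") and the numerator has no diagonal blocks
(`D·E·D = 0 = D'·E·D'`).  Then the cycle `K N_s K N_t K E` crosses from `U` to `W` exactly once (through `E`) and back
exactly once, through the CONNECTING BLOCK `D·N(p)·D'` or a connecting direction `D·N_s·D'`; this file isolates that
bookkeeping in an arbitrary ring:

* `cut_mul`, `cut_one`, `cut_pow`, `cut_sum` — block-upper elements are closed under products, powers, sums;
* ★ `cut_expand3` — for block-upper `X, Y, Z`: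
  `D·XYZ·D' = DXD·DYD·DZD' + DXD·DYD'·D'ZD' + DXD'·D'YD'·D'ZD'` (the switch `U → W` happens once);
* ★ `cut_resolvent_split` — if `K(1 − P) = 1 = (1 − P)K` with `P` block-upper then `D·K·D' = DKD·(D·P·D')·D'KD'`
  (the off-diagonal block of `(1 − P)⁻¹` factors through the connecting block of `P`);
* `trace_mul_eq_trace_cut` — for block-upper `Q` and `E` without diagonal blocks, `tr(Q·E) = tr(D·Q·D'·E)`;
* `rank_of_trace_mul_mul_le₂` — two-family version of ✓ `rank_of_trace_mul_mul_le`: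
  `rank[(s,t) ↦ tr(X_s·Y_t·F)] ≤ m·rank F`.

HONEST FRAMING: algebra only; closes no stub — `stub_dualUnipotent`, 24318, `stub_longMassSlowLawInv`, `VP ≠ VNP` untouched.
No definitions, no named facts, no sorry.
-/

noncomputable section

-- single-conjunct layout `Summits/ValiantsHypothesis/ValiantsHypothesis`: the duplicated namespace component is mandated
set_option linter.dupNamespace false

namespace Summit.ValiantsHypothesis.ValiantsHypothesis.Theorems.GrenetZeon.CutLemma

/-! ### §1 Block calculus for an idempotent in a ring -/

section Ring

variable {R : Type*} [Ring R]

/-- Block-upper elements are closed under products: `D'XD = 0`, `D'YD = 0` ⟹ `D'(XY)D = 0`. [folklore] -/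
theorem cut_mul {D D' X Y : R} (h1 : D + D' = 1) (hX : D' * X * D = 0) (hY : D' * Y * D = 0) :
    D' * (X * Y) * D = 0 := by
  have e : D' * (X * Y) * D = D' * (X * (D + D') * Y) * D := by rw [h1, mul_one]
  have e2 : D' * (X * (D + D') * Y) * D = (D' * X * D) * (Y * D) + (D' * X) * (D' * Y * D) := by
    noncomm_ring
  rw [e, e2, hX, hY, zero_mul, mul_zero, add_zero]

/-- `1` is block-upper. [folklore] -/
theorem cut_one {D D' : R} (hD'D : D' * D = 0) : D' * (1 : R) * D = 0 := by
  rw [mul_one, hD'D]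

/-- Powers of a block-upper element are block-upper. [folklore] -/
theorem cut_pow {D D' X : R} (h1 : D + D' = 1) (hD'D : D' * D = 0) (hX : D' * X * D = 0) (j : ℕ) :
    D' * X ^ j * D = 0 := by
  induction j with
  | zero => rw [pow_zero]; exact cut_one hD'D
  | succ j ih => rw [pow_succ]; exact cut_mul h1 ih hX

/-- Finite sums of block-upper elements are block-upper. [folklore] -/
theorem cut_sum {D D' : R} {ι : Type*} (s : Finset ι) (f : ι → R) (hf : ∀ i ∈ s, D' * f i * D = 0) :
    D' * (∑ i ∈ s, f i) * D = 0 := by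
  rw [Finset.mul_sum, Finset.sum_mul]
  exact Finset.sum_eq_zero hf

/-- ★ **Single switch.**  For an idempotent splitting `D + D' = 1` and block-upper `X, Y, Z`:
`D·(XYZ)·D' = DXD·DYD·DZD' + DXD·DYD'·D'ZD' + DXD'·D'YD'·D'ZD'`. [folklore] -/
theorem cut_expand3 {D D' X Y Z : R} (h1 : D + D' = 1)
    (hD : D * D = D) (hD' : D' * D' = D') (hY : D' * Y * D = 0) :
    D * (X * Y * Z) * D' =
      D * X * D * (D * Y * D) * (D * Z * D') + D * X * D * (D * Y * D') * (D' * Z * D') +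
        D * X * D' * (D' * Y * D') * (D' * Z * D') := by
  -- insert `1 = D + D'` after `X` and after `Y`
  have e : D * (X * Y * Z) * D' = D * (X * (D + D') * Y * (D + D') * Z) * D' := by
    rw [h1, mul_one, mul_one]
  rw [e]
  have hD2 : ∀ M : R, D * (D * M) = D * M := fun M => by rw [← mul_assoc, hD]
  have hD'2 : ∀ M : R, D' * (D' * M) = D' * M := fun M => by rw [← mul_assoc, hD']
  have hY' : ∀ M : R, D' * (Y * (D * M)) = 0 := fun M => by
    rw [← mul_assoc, ← mul_assoc, hY, zero_mul]
  simp only [mul_add, add_mul, mul_assoc, hD2, hD'2, hY', mul_zero, zero_add, add_assoc]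

/-- ★ **The off-diagonal block of a block-upper inverse.**  If `K(1 − P) = 1 = (1 − P)K` and `P` is block-upper,
then `D·K·D' = (DKD)·(DPD')·(D'KD')`. [folklore] -/
theorem cut_resolvent_split {D D' K P : R} (h1 : D + D' = 1) (hDD' : D * D' = 0) (hD'D : D' * D = 0)
    (hD : D * D = D) (hD' : D' * D' = D') (hP : D' * P * D = 0)
    (hK1 : K * (1 - P) = 1) (hK2 : (1 - P) * K = 1) :
    D * K * D' = D * K * D * (D * P * D') * (D' * K * D') := by
  -- `D'(1 − P)D = 0`
  have s1 : D' * (1 - P) * D = 0 := by rw [mul_sub, sub_mul, mul_one, hD'D, hP, sub_zero]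
  -- `DKD · D(1−P)D = D`
  have s2 : D * K * D * (D * (1 - P) * D) = D := by
    have e : D * K * (1 - P) * D = D := by rw [mul_assoc D K, hK1, mul_one, hD]
    have e2 : D * K * (1 - P) * D = D * K * ((D + D') * (1 - P)) * D := by rw [h1, one_mul]
    have e3 : D * K * ((D + D') * (1 - P)) * D =
        D * K * D * (D * (1 - P) * D) + D * K * (D' * (1 - P) * D) := by
      have : D * K * D * (D * (1 - P) * D) = D * K * (D * D) * (1 - P) * D := by noncomm_ring
      rw [this, hD]; noncomm_ring
    rw [e2, e3, s1, mul_zero, add_zero] at e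
    exact e
  -- `D(1−P)D · DKD' + D(1−P)D' · D'KD' = 0`
  have s3 : D * (1 - P) * D * (D * K * D') + D * (1 - P) * D' * (D' * K * D') = 0 := by
    have e : D * ((1 - P) * K) * D' = 0 := by rw [hK2, mul_one, hDD']
    have e2 : D * ((1 - P) * K) * D' = D * ((1 - P) * (D + D') * K) * D' := by rw [h1, mul_one]
    have e3 : D * ((1 - P) * (D + D') * K) * D' =
        D * (1 - P) * D * K * D' + D * (1 - P) * D' * K * D' := by noncomm_ring
    rw [e2, e3] at e
    have e4 : D * (1 - P) * D * (D * K * D') + D * (1 - P) * D' * (D' * K * D') =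
        D * (1 - P) * (D * D) * K * D' + D * (1 - P) * (D' * D') * K * D' := by noncomm_ring
    rw [e4, hD, hD']
    exact e
  -- `D(1−P)D' = −DPD'`
  have s4 : D * (1 - P) * D' = -(D * P * D') := by rw [mul_sub, sub_mul, mul_one, hDD', zero_sub]
  -- combine: left-multiply `s3` by `DKD`
  have s5 : (D * K * D * (D * (1 - P) * D)) * (D * K * D') +
      (D * K * D) * (D * (1 - P) * D') * (D' * K * D') = 0 := by
    have e : (D * K * D * (D * (1 - P) * D)) * (D * K * D') + (D * K * D) * (D * (1 - P) * D') * (D' * K * D') =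
        (D * K * D) * (D * (1 - P) * D * (D * K * D') + D * (1 - P) * D' * (D' * K * D')) := by noncomm_ring
    rw [e, s3, mul_zero]
  rw [s2, s4] at s5
  have e6 : D * (D * K * D') = D * K * D' := by rw [← mul_assoc, ← mul_assoc, hD]
  rw [e6, mul_neg, neg_mul, ← sub_eq_add_neg, sub_eq_zero] at s5
  exact s5

end Ring

/-! ### §2 Traces and ranks -/

section Matrix

open Matrix

variable {m : ℕ} {σ : Type*} [Fintype σ] [DecidableEq σ]

/-- For block-upper `Q` and a numerator `E` without diagonal blocks (`DED = 0 = D'ED'`):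
`tr(Q·E) = tr(D·Q·D'·E)` (the block `D'QD` vanishes, the block `DED'` pairs with `D'QD`). [folklore] -/
theorem trace_mul_eq_trace_cut {D D' Q E : Matrix (Fin m) (Fin m) ℂ} (h1 : D + D' = 1)
    (hQ : D' * Q * D = 0) (hE : D * E * D = 0) (hE' : D' * E * D' = 0) :
    (Q * E).trace = (D * Q * D' * E).trace := by
  have eE : E = D * E * D' + D' * E * D := by
    have e : E = (D + D') * E * (D + D') := by rw [h1, Matrix.one_mul, Matrix.mul_one]
    have e2 : (D + D') * E * (D + D') = D * E * D + D * E * D' + (D' * E * D + D' * E * D') := by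
      noncomm_ring
    rw [e2, hE, hE', zero_add, add_zero] at e
    exact e
  conv_lhs => rw [eE]
  rw [Matrix.mul_add, Matrix.trace_add]
  have h0 : (Q * (D * E * D')).trace = 0 := by
    rw [show Q * (D * E * D') = (Q * D * E) * D' by simp only [Matrix.mul_assoc], Matrix.trace_mul_comm,
      show D' * (Q * D * E) = (D' * Q * D) * E by simp only [Matrix.mul_assoc], hQ, Matrix.zero_mul,
      Matrix.trace_zero]
  rw [h0, zero_add, show Q * (D' * E * D) = (Q * D' * E) * D by simp only [Matrix.mul_assoc],
    Matrix.trace_mul_comm, show D * (Q * D' * E) = D * Q * D' * E by simp only [Matrix.mul_assoc]]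

omit [DecidableEq σ] in
/-- Two-family version of ✓ `rank_of_trace_mul_mul_le`: `rank[(s,t) ↦ tr(X_s·Y_t·F)] ≤ m·rank F`. [folklore] -/
theorem rank_of_trace_mul_mul_le₂ (X Y : σ → Matrix (Fin m) (Fin m) ℂ) (F : Matrix (Fin m) (Fin m) ℂ) :
    (Matrix.of fun s t : σ => (X s * Y t * F).trace).rank ≤ m * F.rank := by
  have hsum : (Matrix.of fun s t : σ => (X s * Y t * F).trace) =
      ∑ i : Fin m, (Matrix.of fun (s : σ) (k : Fin m) => X s k i) * Fᵀ *
        (Matrix.of fun (l : Fin m) (t : σ) => Y t i l) := by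
    refine Matrix.ext fun s t => ?_
    simp only [Matrix.of_apply, Matrix.trace, Matrix.diag_apply, Matrix.mul_apply, Matrix.sum_apply,
      Matrix.transpose_apply, Finset.sum_mul]
    calc (∑ x, ∑ y, ∑ z, X s x z * Y t z y * F y x)
        = ∑ x, ∑ z, ∑ y, X s x z * Y t z y * F y x := Finset.sum_congr rfl fun x _ => Finset.sum_comm
      _ = ∑ z, ∑ x, ∑ y, X s x z * Y t z y * F y x := Finset.sum_comm
      _ = ∑ z, ∑ y, ∑ x, X s x z * F y x * Y t z y := Finset.sum_congr rfl fun z _ => by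
          rw [Finset.sum_comm]
          exact Finset.sum_congr rfl fun y _ => Finset.sum_congr rfl fun x _ => by ring
  rw [hsum]
  refine (Literature.Computability.AlgebraicComplexity.rank_sum_le _ _).trans ?_
  have hi : ∀ i : Fin m, ((Matrix.of fun (s : σ) (k : Fin m) => X s k i) * Fᵀ *
      (Matrix.of fun (l : Fin m) (t : σ) => Y t i l)).rank ≤ F.rank := fun i =>
    ((Matrix.rank_mul_le_left _ _).trans (Matrix.rank_mul_le_right _ _)).trans (Matrix.rank_transpose F).le
  refine (Finset.sum_le_sum fun i _ => hi i).trans ?_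
  simp

end Matrix

end Summit.ValiantsHypothesis.ValiantsHypothesis.Theorems.GrenetZeon.CutLemma

end
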